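import Summits.QuantumFields.YangMills.Theorems.BalabanUVNodesN21HistoriesAbsorbingDefs

/-!
# N21 (NE7c) — module 20m «MARGINAL ENVELOPES» (LENS nearmiss ROW A⁷, v9.0∕v10.0): road I on history families with the per-slot dominating laws
# living on `ℝ` and enveloping only the slot's OWN-statistic marginal; the v9.0 junction with 20k's absorbing closeness

PROVENANCE AND CREDIT.  This module is the planner seat `ym-lens-BalabanUVNodes-nearmiss`'s `Sketch-nearmiss-g10.lean` §M1∕§M2∕§M3∕§AM
(sha16 cf6ca6ea925d752d, = `Sketch-nearmiss-g9.lean` §M1–§AM; memo `LENS-nearmiss.md` v9.0 Card 27 ∕ v10.0 §4 ROW A⁷) landed VERBATIM by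
seat `pub-ymgap-dag-n21-e` (g8) under dag-lead g8 DEDUP-267 (4) «ROW A⁷∕A⁸ 20n OWNER WORD: n21-d first refusal by 09:30Z, silence ⇒ n21-e»
(bus l.18149); only this header, the namespace and the citation lines are the filer's.  Lane: `--kind proof --supports stmt-QuantumFields-20292 --as helper`
(K3⁗ `SpineGivenEndpointR13Sep`).  Count-neutral.  Companion: module 20n `…N21HistoriesResamplingTower` (Sketch-g10 §L∕§N∕§T∕§D∕§J).

THE IDEA (lens Card 27, kernel sentences here).  Module 20 (`…N21SelectedThresholdsHistories`, dag-n21-d) put the per-slot OLDER-CAUSAL dominating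
laws on the joint space `Ω K`; but 18b's selection and the piece push only ever evaluate such a law on the slot's own shell `{a(1−ρ) ≤ u_s < a}` and on
`univ` — so the law may live on `ℝ` and dominate only the `u_s`-MARGINAL of the `s`-small partial sum (`henv : (partialLaw …).map (u K s) ≤ M₁ • law K a s`),
with comparable mass (`hmass`).  §M1: the shell mass of a law is the shell mass of its marginal; an Ω-envelope is a marginal envelope.  §M2: ONE RUN —
module 20's level ledger from marginal envelopes.  §M3: TWO RUNS — one selected admissible assignment for both runs' laws on `ℝ` (18b's
`exists_goodAssignment` on the joint slot family `C K × {A,B}`, `2ν̄` per level), both ledgers at it, `ShellWeightBound` with module 20's constant; module 20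
is the special case `law ↦ law.map u_s`.  §AM: THE v9.0 JUNCTION — closeness from 20k's `ae_close_of_absorbing` (N16-det at the nominal `θ` on
`nbhd ⊆ smAll` + absorption at the selected `a`), (M1)-currency = older-causal MARGINAL envelopes: `shellWeightBound_histories_of_absorbing_marginal`
(20l's `shellWeightBound_histories_of_absorbing` with the a-free resummation `hsumX` — strained by print's ℝ, lens Card 26 — REPLACED by
`henvX`∕`hdepX`∕`hmassX`, which survive ℝ given the resampling tower of 20n).

HONEST FRAMING.  NE7c is NOT PRINTED and NOT PROVED.  [folklore] measure bookkeeping (`Measure.map`, finite sums, 18b's selection cited by name) whose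
only content is WHICH binder road I displays at ℝ-levels; the laws, `hdep`, `M₁`, `M₂` are NODE O's (at 𝐓-only levels discharged by 20e∕20l, at ℝ-levels by
20n's tower binders + the one local number `δ_loc`, lens Card 30); nothing of Bałaban's asserted; (M1) at print's FIXED thresholds untouched; N21 NOT
discharged; count-neutral; one finite 𝕋⁴ at fixed `ε`; NOT ℝ⁴ ∕ OS ∕ gap ∕ Clay.

CITATION HEADER (lean-in-tree rule 2026-08-18).  BY NAME: 18b `N21SelectedThresholds.exists_goodAssignment` ∕ `levelLedger_of_goodAssignment` ∕ `levelConst_le`;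
module 20 `N21SelectedThresholdsHistories.toReal_le_of_le_smul`; leaf `ShellMeasureRootCompositionHistories.histWeight` ∕ `histShell` ∕ `histPiece` ∕ `histLaw` ∕
`partialLaw` ∕ `sum_histPiece_le`; n21-a `n21_knit_levels_geometric`; 20k `N21HistoriesAbsorbingDefs.Absorbing` ∕ `ae_close_of_absorbing`;
`T4ShellMeasure.SlotAntiConcentration`; `T4ShellMeasureLevels.LevelLedger` ∕ `LiveWindow`; `T4IndicatorShell.ShellWeightBound`.  Context only (SHAPE):
[Balaban1989LargeFieldI] (0.3)–(0.4) p. 176 (what ℝ preserves: integrals of densities).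

WHAT IS PROVED ([folklore]).  §M1 `measure_shell_eq_map` · `marginalEnvelope_of_envelope` · `map_univ_eq`; §M2 ★ `levelLedger_histories_of_marginalEnvelopes`;
§M3 ★ `exists_goodAssignment_pair` · ★ `levelLedgers_histories_of_marginalEnvelopes` · ★ `shellWeightBound_histories_of_marginalEnvelopes` ·
`marginal_binders_of_envelope`; §AM ★★ `shellWeightBound_histories_of_absorbing_marginal`.
-/

open scoped BigOperators ENNReal
open MeasureTheory Set

namespace Summit.QuantumFields.YangMills.Theorems.N21HistoriesMarginalEnvelopes

open Literature.MathematicalPhysics.QuantumFieldTheory.Balaban1983to89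
open Literature.MathematicalPhysics.QuantumFieldTheory.Balaban1983to89.T4ShellMeasure (SlotAntiConcentration)
open T4IndicatorShell (smallInd ShellWeightBound)
open T4ShellMeasureLevels (LevelLedger LiveWindow)
open Summit.QuantumFields.BalabanUV.T4Continuum.ShellMeasureRootCompositionHistories
  (smallProd histWeight histShell histPiece histLaw partialLaw histShell_nonneg histShell_le_histWeight histShell_le_sum_piece sum_histPiece_le
    integral_piece_le isFiniteMeasure_histLaw)
open Summit.QuantumFields.YangMills.Theorems (n21_knit_levels_geometric)
open Summit.QuantumFields.YangMills.Theorems.N21SelectedThresholds (exists_goodAssignment levelLedger_of_goodAssignment levelConst_le)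
open Summit.QuantumFields.YangMills.Theorems.N21SelectedThresholdsHistories (toReal_le_of_le_smul)
open Summit.QuantumFields.YangMills.Theorems.N21HistoriesAbsorbingDefs (Absorbing ae_close_of_absorbing histLaw_eq_restrict histWeight_of_absorbing)
open Literature.MathematicalPhysics.QuantumFieldTheory.Balaban1983to89.T4LimitDensity (smul_le_smul_measure)
open Summit.QuantumFields.YangMills.Theorems.N21HistoriesModelADefs (withDensity_finsetSum')

/-! ## §M (= Sketch-g9 §M1–§M3 verbatim) marginal envelopes on `ℝ` -/

/-! ## §M1 the shell mass of a law is the shell mass of its own-statistic marginal -/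

section Marginal

variable {Ω : Type*} [MeasurableSpace Ω]

/-- `μ{lo ≤ u < hi} = (u_* μ)[lo, hi)`. [folklore] -/
theorem measure_shell_eq_map (μ : Measure Ω) {u : Ω → ℝ} (hu : Measurable u) (lo hi : ℝ) :
    μ {x | lo ≤ u x ∧ u x < hi} = μ.map u {r | lo ≤ r ∧ r < hi} := by
  have hE : MeasurableSet {r : ℝ | lo ≤ r ∧ r < hi} := measurableSet_Ico
  rw [Measure.map_apply hu hE]
  rfl

/-- an Ω-valued envelope is in particular a marginal envelope: `μ ≤ M • law ⟹ u_* μ ≤ M • u_* law` (module 20's envelopes are the special case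
`law ↦ law.map u_s` of §M2's). [folklore] -/
theorem marginalEnvelope_of_envelope {μ law : Measure Ω} {M : ℝ≥0∞} {u : Ω → ℝ} (hu : Measurable u) (h : μ ≤ M • law) :
    μ.map u ≤ M • law.map u := by
  rw [← Measure.map_smul]
  exact Measure.map_mono h hu

/-- … with the same total mass. [folklore] -/
theorem map_univ_eq {law : Measure Ω} {u : Ω → ℝ} (hu : Measurable u) : law.map u univ = law univ := by
  rw [Measure.map_apply hu MeasurableSet.univ, preimage_univ]

end Marginal

/-! ## §M2 ONE RUN: the level ledger of a history family from MARGINAL envelopes by older-causal laws on `ℝ` -/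

section OneRun

variable {Ω : ℕ → Type*} [∀ K, MeasurableSpace (Ω K)] {σ ι : Type*} [DecidableEq σ]
  {T : ℕ → Finset ι} {C : ℕ → Finset σ} {small : ℕ → ι → Finset σ} {lvl : ℕ → σ → ℕ}
  {ν : ∀ K : ℕ, (ℕ → ℝ) → ℝ → ι → Measure (Ω K)} [∀ K a t τ, IsFiniteMeasure (ν K a t τ)]
  {law : ∀ K : ℕ, (ℕ → ℝ) → σ → Measure ℝ} [∀ K a s, IsFiniteMeasure (law K a s)]
  {u v : ∀ K : ℕ, σ → Ω K → ℝ} {ρ D' : ℕ → ℝ} {l₀ M₁ M₂ : ℝ}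

/-- **ONE RUN, MARGINAL ENVELOPES.**  Module 20's `levelLedger_histories_of_goodAssignment` with the per-slot law living on `ℝ` (it is only ever
evaluated on the slot's OWN shell `[a(1−ρ), a)` and on `univ`): (M1) for `(law K a s, id)` at the slot's level threshold, the MARGINAL envelope
`(partialLaw_s).map (u K s) ≤ M₁ • law K a s`, the mass control `M₂·law(univ) ≤ Σ_τ A_τ`, closeness as in 20.  Same conclusion, same constants. [folklore] -/
theorem levelLedger_histories_of_marginalEnvelopes (a : ℕ → ℕ → ℝ)
    (hu : ∀ K s, Measurable (u K s)) (hv : ∀ K s, Measurable (v K s))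
    (hsmall : ∀ K, ∀ τ ∈ T K, small K τ ⊆ C K)
    (hgood : ∀ K, ∀ s ∈ C K, SlotAntiConcentration (law K (a K) s) (fun r : ℝ => r) (a K (lvl K s)) (ρ (lvl K s)) (D' (lvl K s)))
    (hD' : ∀ j, 0 ≤ D' j) (hρ0 : ∀ j, 0 ≤ ρ j) (hM₁ : 0 ≤ M₁) (hM₂ : 0 < M₂)
    (hclose : ∀ K t, |t| ≤ l₀ → ∀ τ ∈ T K, ∀ s ∈ small K τ,
      ∀ᵐ ω ∂(ν K (a K) t τ), |u K s ω - v K s ω| ≤ ρ (lvl K s) * a K (lvl K s))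
    (henv : ∀ K t, |t| ≤ l₀ → ∀ s ∈ C K,
      (partialLaw (T K) (ν K (a K) t) (small K) (u K) (fun s => a K (lvl K s)) s).map (u K s) ≤ ENNReal.ofReal M₁ • law K (a K) s)
    (hmass : ∀ K t, |t| ≤ l₀ → ∀ s ∈ C K, M₂ * (law K (a K) s univ).toReal ≤
      ∑ τ ∈ T K, histWeight (ν K (a K) t τ) (small K τ) (u K) (fun s => a K (lvl K s))) :
    LevelLedger l₀ T (fun K t τ => histWeight (ν K (a K) t τ) (small K τ) (u K) (fun s => a K (lvl K s)))
      (fun K t τ => histShell (ν K (a K) t τ) (small K τ) (u K) (v K) (fun s => a K (lvl K s))) C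
      (fun K t s τ => histPiece (ν K (a K) t τ) (small K τ) (u K) (v K) (fun s => a K (lvl K s)) s) lvl
      (fun j => M₁ / M₂ * D' j) ρ := by
  -- the piece push: pieces ≤ the partial law's own-shell mass (leaf) = the marginal's shell mass ≤ M₁ × the law's
  have hpush : ∀ K t, |t| ≤ l₀ → ∀ s ∈ C K,
      ∑ τ ∈ T K, histPiece (ν K (a K) t τ) (small K τ) (u K) (v K) (fun s => a K (lvl K s)) s ≤
        M₁ * (law K (a K) s {r | a K (lvl K s) * (1 - ρ (lvl K s)) ≤ r ∧ r < a K (lvl K s)}).toReal := by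
    intro K t ht s hs
    have h1 := sum_histPiece_le (T K) (ν K (a K) t) (small K) (hu K) (uB := v K) (ϑ := fun s => a K (lvl K s))
      (ρ := ρ (lvl K s)) (s := s) fun τ hτ hsm => hclose K t ht τ hτ s hsm
    rw [one_mul, measure_shell_eq_map _ (hu K s)] at h1
    exact h1.trans (toReal_le_of_le_smul hM₁ (henv K t ht s hs) _)
  exact levelLedger_of_goodAssignment (X := fun _ _ => ℝ) (ν := law) (w := fun _ _ r => r) (lvl := lvl) (ρ := ρ) (l₀ := l₀) (T := T)
    (S := C) (A := fun K b t τ => histWeight (ν K b t τ) (small K τ) (u K) (fun s => b (lvl K s)))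
    (sh := fun K b t τ => histShell (ν K b t τ) (small K τ) (u K) (v K) (fun s => b (lvl K s)))
    (piece := fun K b t s τ => histPiece (ν K b t τ) (small K τ) (u K) (v K) (fun s => b (lvl K s)) s)
    (M₁ := M₁) (M₂ := M₂) (D' := D') a hgood hD' hρ0 hM₁ hM₂
    (fun K t _ τ _ => histShell_nonneg _ _ _ _ _)
    (fun K t _ τ _ => histShell_le_histWeight _ _ (hu K) _ _)
    (fun K t _ τ hτ => histShell_le_sum_piece _ (hsmall K τ hτ) (hu K) (hv K) _)
    hpush hmass

end OneRun

/-! ## §M3 TWO RUNS: ONE selected admissible assignment per comparison from older-causal MARGINAL laws, both ledgers at it -/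

section TwoRuns

variable {Ω : ℕ → Type*} [∀ K, MeasurableSpace (Ω K)] {σ ι : Type*} [DecidableEq σ]
  {T : ℕ → Finset ι} {C : ℕ → Finset σ} {small smAll : ℕ → ι → Finset σ} {nbhd : ℕ → ι → σ → Finset σ} {lvl : ℕ → σ → ℕ}
  {νA νB : ∀ K : ℕ, (ℕ → ℝ) → ℝ → ι → Measure (Ω K)} [∀ K a t τ, IsFiniteMeasure (νA K a t τ)] [∀ K a t τ, IsFiniteMeasure (νB K a t τ)]
  {lawA lawB : ∀ K : ℕ, (ℕ → ℝ) → σ → Measure ℝ} [∀ K a s, IsFiniteMeasure (lawA K a s)] [∀ K a s, IsFiniteMeasure (lawB K a s)]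
  {uA uB : ∀ K : ℕ, σ → Ω K → ℝ} {θ κ ρ Δ : ℕ → ℝ} {l₀ M₁ M₂ νbar δ : ℝ}

/-- **ONE GOOD ADMISSIBLE ASSIGNMENT FOR BOTH RUNS' LAWS ON `ℝ`** — 18b's `exists_goodAssignment` on the joint slot family `C K × {A, B}` with spaces `ℝ`,
statistic `id`, at most `2ν̄` slots per level. [folklore] -/
theorem exists_goodAssignment_pair
    (hθ : ∀ j, 0 < θ j) (hκ : ∀ j, 0 < κ j ∧ κ j ≤ 1) (hρ : ∀ j, 0 ≤ ρ j ∧ ρ j < 1)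
    (hcount : ∀ K m, ((((C K).filter fun s => lvl K s = m).card : ℕ) : ℝ) ≤ νbar)
    (hdepA : ∀ (K : ℕ) (s : σ) (a b : ℕ → ℝ), (∀ i, i < lvl K s → a i = b i) → lawA K a s = lawA K b s)
    (hdepB : ∀ (K : ℕ) (s : σ) (a b : ℕ → ℝ), (∀ i, i < lvl K s → a i = b i) → lawB K a s = lawB K b s) :
    ∃ a : ℕ → ℕ → ℝ, (∀ K j, a K j ∈ Icc ((1 - κ j) * θ j) (θ j)) ∧
      (∀ K, ∀ s ∈ C K, lvl K s ≤ K → SlotAntiConcentration (lawA K (a K) s) (fun r : ℝ => r) (a K (lvl K s)) (ρ (lvl K s))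
        (2 * νbar / ((1 - ρ (lvl K s)) * κ (lvl K s)))) ∧
      (∀ K, ∀ s ∈ C K, lvl K s ≤ K → SlotAntiConcentration (lawB K (a K) s) (fun r : ℝ => r) (a K (lvl K s)) (ρ (lvl K s))
        (2 * νbar / ((1 - ρ (lvl K s)) * κ (lvl K s)))) := by
  classical
  -- the joint slot family of both runs on `σ × Bool`, every slot read on `ℝ` by the identity
  let SA' : ℕ → Finset (σ × Bool) := fun K => (C K).image fun s => (s, true)
  let SB' : ℕ → Finset (σ × Bool) := fun K => (C K).image fun s => (s, false)
  let lvl' : ℕ → σ × Bool → ℕ := fun K s' => lvl K s'.1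
  let ν' : ∀ K : ℕ, (ℕ → ℝ) → ∀ s' : σ × Bool, Measure ℝ := fun K a s' => bif s'.2 then lawA K a s'.1 else lawB K a s'.1
  let w' : ∀ (K : ℕ) (s' : σ × Bool), ℝ → ℝ := fun _ _ r => r
  have hfin' : ∀ K a s', IsFiniteMeasure (ν' K a s') := fun K a s' => by
    rcases s' with ⟨s, _ | _⟩
    · show IsFiniteMeasure (lawB K a s); infer_instance
    · show IsFiniteMeasure (lawA K a s); infer_instance
  have hw' : ∀ K s', Measurable (w' K s') := fun _ _ => measurable_id
  have hdep' : ∀ (K : ℕ) (s' : σ × Bool) (a b : ℕ → ℝ), (∀ i, i < lvl' K s' → a i = b i) → ν' K a s' = ν' K b s' :=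
    fun K s' a b hab => by
    rcases s' with ⟨s, _ | _⟩
    · exact hdepB K s a b hab
    · exact hdepA K s a b hab
  have hcnt : ∀ (K m : ℕ) (b : Bool),
      (((C K).image fun s => (s, b)).filter fun s' => lvl' K s' = m).card = ((C K).filter fun s => lvl K s = m).card := by
    intro K m b
    rw [Finset.filter_image, Finset.card_image_of_injective _ fun s₁ s₂ h => congrArg Prod.fst h]
  have hcard' : ∀ K m, ((((SA' K ∪ SB' K).filter fun s' => lvl' K s' = m).card : ℕ) : ℝ) ≤ 2 * νbar := by
    intro K m
    have h := hcount K m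
    have hc : ((SA' K ∪ SB' K).filter fun s' => lvl' K s' = m).card ≤ 2 * ((C K).filter fun s => lvl K s = m).card := by
      rw [Finset.filter_union]
      refine (Finset.card_union_le _ _).trans ?_
      show (((C K).image fun s => (s, true)).filter fun s' => lvl' K s' = m).card +
          (((C K).image fun s => (s, false)).filter fun s' => lvl' K s' = m).card ≤ _
      rw [hcnt K m true, hcnt K m false]
      omega
    calc ((((SA' K ∪ SB' K).filter fun s' => lvl' K s' = m).card : ℕ) : ℝ)
        ≤ ((2 * ((C K).filter fun s => lvl K s = m).card : ℕ) : ℝ) := by exact_mod_cast hc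
      _ = 2 * ((((C K).filter fun s => lvl K s = m).card : ℕ) : ℝ) := by push_cast; ring
      _ ≤ 2 * νbar := by linarith
  -- 18b's selection on the joint family, spaces `ℝ`
  have hsel := fun K => exists_goodAssignment (X := fun _ _ => ℝ) (SA := SA') (SB := SB') (lvl := lvl') (ν := ν') (w := w')
    (θ := θ) (κ := κ) (ρ := ρ) (Fbar := 2 * νbar) hw' hθ hκ hρ hdep' hcard' K
  choose a hadm hgood using hsel
  have hmemA : ∀ K, ∀ s ∈ C K, (s, true) ∈ SA' K ∪ SB' K := fun K s hs =>
    Finset.mem_union_left _ (Finset.mem_image_of_mem _ hs)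
  have hmemB : ∀ K, ∀ s ∈ C K, (s, false) ∈ SA' K ∪ SB' K := fun K s hs =>
    Finset.mem_union_right _ (Finset.mem_image_of_mem _ hs)
  exact ⟨a, hadm, fun K s hs hle => hgood K (s, true) (hmemA K s hs) hle, fun K s hs hle => hgood K (s, false) (hmemB K s hs) hle⟩

/-- **BOTH RUNS' HISTORY LEDGERS AT THE SAME SELECTED THRESHOLDS, MARGINAL ENVELOPES.**  Module 20's `levelLedgers_histories_of_selectedThresholds`
with per-run, per-slot OLDER-CAUSAL (`hdep`) finite laws ON `ℝ` and the envelope binders weakened to the marginals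
`(partialLaw^X_s).map (u^X K s) ≤ M₁ • law^X K a s`; selection = 18b's `exists_goodAssignment` on the joint slot family with `X K s := ℝ`, `w := id`.
Same constants `D j = (M₁∕M₂)·2ν̄∕((1 − ρ_j)κ_j)`. [folklore] -/
theorem levelLedgers_histories_of_marginalEnvelopes
    (huA : ∀ K s, Measurable (uA K s)) (huB : ∀ K s, Measurable (uB K s))
    (hsmall : ∀ K, ∀ τ ∈ T K, small K τ ⊆ C K)
    (hθ : ∀ j, 0 < θ j) (hκ : ∀ j, 0 < κ j ∧ κ j ≤ 1) (hρ : ∀ j, 0 ≤ ρ j ∧ ρ j < 1)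
    (hcount : ∀ K m, ((((C K).filter fun s => lvl K s = m).card : ℕ) : ℝ) ≤ νbar)
    (hle : ∀ K, ∀ s ∈ C K, lvl K s ≤ K) (hM₁ : 0 ≤ M₁) (hM₂ : 0 < M₂)
    (hdepA : ∀ (K : ℕ) (s : σ) (a b : ℕ → ℝ), (∀ i, i < lvl K s → a i = b i) → lawA K a s = lawA K b s)
    (hdepB : ∀ (K : ℕ) (s : σ) (a b : ℕ → ℝ), (∀ i, i < lvl K s → a i = b i) → lawB K a s = lawB K b s)
    (hΔ : ∀ j, Δ j ≤ ρ j * ((1 - κ j) * θ j))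
    (hcloseA : ∀ (K : ℕ) (a : ℕ → ℝ), (∀ j, a j ∈ Icc ((1 - κ j) * θ j) (θ j)) → ∀ t, |t| ≤ l₀ → ∀ τ ∈ T K, ∀ s ∈ small K τ,
      ∀ᵐ ω ∂(νA K a t τ), |uA K s ω - uB K s ω| ≤ Δ (lvl K s))
    (hcloseB : ∀ (K : ℕ) (a : ℕ → ℝ), (∀ j, a j ∈ Icc ((1 - κ j) * θ j) (θ j)) → ∀ t, |t| ≤ l₀ → ∀ τ ∈ T K, ∀ s ∈ small K τ,
      ∀ᵐ ω ∂(νB K a t τ), |uB K s ω - uA K s ω| ≤ Δ (lvl K s))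
    (henvA : ∀ (K : ℕ) (a : ℕ → ℝ), (∀ j, a j ∈ Icc ((1 - κ j) * θ j) (θ j)) → ∀ t, |t| ≤ l₀ → ∀ s ∈ C K,
      (partialLaw (T K) (νA K a t) (small K) (uA K) (fun s => a (lvl K s)) s).map (uA K s) ≤ ENNReal.ofReal M₁ • lawA K a s)
    (henvB : ∀ (K : ℕ) (a : ℕ → ℝ), (∀ j, a j ∈ Icc ((1 - κ j) * θ j) (θ j)) → ∀ t, |t| ≤ l₀ → ∀ s ∈ C K,
      (partialLaw (T K) (νB K a t) (small K) (uB K) (fun s => a (lvl K s)) s).map (uB K s) ≤ ENNReal.ofReal M₁ • lawB K a s)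
    (hmassA : ∀ (K : ℕ) (a : ℕ → ℝ), (∀ j, a j ∈ Icc ((1 - κ j) * θ j) (θ j)) → ∀ t, |t| ≤ l₀ → ∀ s ∈ C K,
      M₂ * (lawA K a s univ).toReal ≤ ∑ τ ∈ T K, histWeight (νA K a t τ) (small K τ) (uA K) (fun s => a (lvl K s)))
    (hmassB : ∀ (K : ℕ) (a : ℕ → ℝ), (∀ j, a j ∈ Icc ((1 - κ j) * θ j) (θ j)) → ∀ t, |t| ≤ l₀ → ∀ s ∈ C K,
      M₂ * (lawB K a s univ).toReal ≤ ∑ τ ∈ T K, histWeight (νB K a t τ) (small K τ) (uB K) (fun s => a (lvl K s))) :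
    ∃ a : ℕ → ℕ → ℝ, (∀ K j, a K j ∈ Icc ((1 - κ j) * θ j) (θ j)) ∧
      LevelLedger l₀ T (fun K t τ => histWeight (νA K (a K) t τ) (small K τ) (uA K) (fun s => a K (lvl K s)))
        (fun K t τ => histShell (νA K (a K) t τ) (small K τ) (uA K) (uB K) (fun s => a K (lvl K s))) C
        (fun K t s τ => histPiece (νA K (a K) t τ) (small K τ) (uA K) (uB K) (fun s => a K (lvl K s)) s) lvl
        (fun j => M₁ / M₂ * (2 * νbar / ((1 - ρ j) * κ j))) ρ ∧
      LevelLedger l₀ T (fun K t τ => histWeight (νB K (a K) t τ) (small K τ) (uB K) (fun s => a K (lvl K s)))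
        (fun K t τ => histShell (νB K (a K) t τ) (small K τ) (uB K) (uA K) (fun s => a K (lvl K s))) C
        (fun K t s τ => histPiece (νB K (a K) t τ) (small K τ) (uB K) (uA K) (fun s => a K (lvl K s)) s) lvl
        (fun j => M₁ / M₂ * (2 * νbar / ((1 - ρ j) * κ j))) ρ := by
  obtain ⟨a, hadm, hgA, hgB⟩ := exists_goodAssignment_pair (lawA := lawA) (lawB := lawB) hθ hκ hρ hcount hdepA hdepB
  have hgoodA : ∀ K, ∀ s ∈ C K, SlotAntiConcentration (lawA K (a K) s) (fun r : ℝ => r) (a K (lvl K s)) (ρ (lvl K s))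
      (2 * νbar / ((1 - ρ (lvl K s)) * κ (lvl K s))) := fun K s hs => hgA K s hs (hle K s hs)
  have hgoodB : ∀ K, ∀ s ∈ C K, SlotAntiConcentration (lawB K (a K) s) (fun r : ℝ => r) (a K (lvl K s)) (ρ (lvl K s))
      (2 * νbar / ((1 - ρ (lvl K s)) * κ (lvl K s))) := fun K s hs => hgB K s hs (hle K s hs)
  have hνbar : 0 ≤ νbar := (Nat.cast_nonneg _).trans (hcount 0 0)
  have hD' : ∀ j, 0 ≤ 2 * νbar / ((1 - ρ j) * κ j) := fun j => by
    have h1 : 0 < 1 - ρ j := by linarith [(hρ j).2]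
    have h2 := (hκ j).1
    positivity
  have hrad : ∀ K j, Δ j ≤ ρ j * a K j := fun K j =>
    (hΔ j).trans (mul_le_mul_of_nonneg_left (hadm K j).1 (hρ j).1)
  refine ⟨a, hadm, ?_, ?_⟩
  · exact levelLedger_histories_of_marginalEnvelopes (ν := νA) (law := lawA) (u := uA) (v := uB) a huA huB hsmall hgoodA hD'
      (fun j => (hρ j).1) hM₁ hM₂
      (fun K t ht τ hτ s hs => (hcloseA K (a K) (hadm K) t ht τ hτ s hs).mono fun ω hω => hω.trans (hrad K _))
      (fun K t ht s hs => henvA K (a K) (hadm K) t ht s hs) (fun K t ht s hs => hmassA K (a K) (hadm K) t ht s hs)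
  · exact levelLedger_histories_of_marginalEnvelopes (ν := νB) (law := lawB) (u := uB) (v := uA) a huB huA hsmall hgoodB hD'
      (fun j => (hρ j).1) hM₁ hM₂
      (fun K t ht τ hτ s hs => (hcloseB K (a K) (hadm K) t ht τ hτ s hs).mono fun ω hω => hω.trans (hrad K _))
      (fun K t ht s hs => henvB K (a K) (hadm K) t ht s hs) (fun K t ht s hs => hmassB K (a K) (hadm K) t ht s hs)

/-- **N21's ROAD I ON HISTORY FAMILIES FROM OLDER-CAUSAL MARGINAL ENVELOPES** — module 20's `shellWeightBound_histories_of_selectedThresholds` with laws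
on `ℝ` and marginal envelopes; same constant `C·ϑ^K`, `C = 2((N₁+1)·ν̄·(M₁∕M₂·(4ν̄∕κ_min))·c₁·ϑ^{−N₁})`. [folklore] -/
theorem shellWeightBound_histories_of_marginalEnvelopes {N₁ : ℕ} {κmin c₁ ϑ : ℝ}
    (huA : ∀ K s, Measurable (uA K s)) (huB : ∀ K s, Measurable (uB K s))
    (hsmall : ∀ K, ∀ τ ∈ T K, small K τ ⊆ C K)
    (hθ : ∀ j, 0 < θ j) (hκ : ∀ j, 0 < κ j ∧ κ j ≤ 1) (hρ : ∀ j, 0 ≤ ρ j ∧ ρ j < 1)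
    (hwin : LiveWindow C lvl N₁ νbar) (hM₁ : 0 ≤ M₁) (hM₂ : 0 < M₂)
    (hdepA : ∀ (K : ℕ) (s : σ) (a b : ℕ → ℝ), (∀ i, i < lvl K s → a i = b i) → lawA K a s = lawA K b s)
    (hdepB : ∀ (K : ℕ) (s : σ) (a b : ℕ → ℝ), (∀ i, i < lvl K s → a i = b i) → lawB K a s = lawB K b s)
    (hΔ : ∀ j, Δ j ≤ ρ j * ((1 - κ j) * θ j))
    (hcloseA : ∀ (K : ℕ) (a : ℕ → ℝ), (∀ j, a j ∈ Icc ((1 - κ j) * θ j) (θ j)) → ∀ t, |t| ≤ l₀ → ∀ τ ∈ T K, ∀ s ∈ small K τ,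
      ∀ᵐ ω ∂(νA K a t τ), |uA K s ω - uB K s ω| ≤ Δ (lvl K s))
    (hcloseB : ∀ (K : ℕ) (a : ℕ → ℝ), (∀ j, a j ∈ Icc ((1 - κ j) * θ j) (θ j)) → ∀ t, |t| ≤ l₀ → ∀ τ ∈ T K, ∀ s ∈ small K τ,
      ∀ᵐ ω ∂(νB K a t τ), |uB K s ω - uA K s ω| ≤ Δ (lvl K s))
    (henvA : ∀ (K : ℕ) (a : ℕ → ℝ), (∀ j, a j ∈ Icc ((1 - κ j) * θ j) (θ j)) → ∀ t, |t| ≤ l₀ → ∀ s ∈ C K,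
      (partialLaw (T K) (νA K a t) (small K) (uA K) (fun s => a (lvl K s)) s).map (uA K s) ≤ ENNReal.ofReal M₁ • lawA K a s)
    (henvB : ∀ (K : ℕ) (a : ℕ → ℝ), (∀ j, a j ∈ Icc ((1 - κ j) * θ j) (θ j)) → ∀ t, |t| ≤ l₀ → ∀ s ∈ C K,
      (partialLaw (T K) (νB K a t) (small K) (uB K) (fun s => a (lvl K s)) s).map (uB K s) ≤ ENNReal.ofReal M₁ • lawB K a s)
    (hmassA : ∀ (K : ℕ) (a : ℕ → ℝ), (∀ j, a j ∈ Icc ((1 - κ j) * θ j) (θ j)) → ∀ t, |t| ≤ l₀ → ∀ s ∈ C K,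
      M₂ * (lawA K a s univ).toReal ≤ ∑ τ ∈ T K, histWeight (νA K a t τ) (small K τ) (uA K) (fun s => a (lvl K s)))
    (hmassB : ∀ (K : ℕ) (a : ℕ → ℝ), (∀ j, a j ∈ Icc ((1 - κ j) * θ j) (θ j)) → ∀ t, |t| ≤ l₀ → ∀ s ∈ C K,
      M₂ * (lawB K a s univ).toReal ≤ ∑ τ ∈ T K, histWeight (νB K a t τ) (small K τ) (uB K) (fun s => a (lvl K s)))
    (hκmin : 0 < κmin) (hκminle : ∀ j, κmin ≤ κ j) (hρhalf : ∀ j, ρ j ≤ 1 / 2)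
    (hϑ0 : 0 < ϑ) (hϑ1 : ϑ < 1) (hrate : ∀ j, ρ j ≤ c₁ * ϑ ^ j) :
    ∃ a : ℕ → ℕ → ℝ, (∀ K j, a K j ∈ Icc ((1 - κ j) * θ j) (θ j)) ∧
      ShellWeightBound l₀ T (fun K t τ => histWeight (νA K (a K) t τ) (small K τ) (uA K) (fun s => a K (lvl K s)))
        (fun K t τ => histWeight (νB K (a K) t τ) (small K τ) (uB K) (fun s => a K (lvl K s)))
        (fun K t τ => histShell (νA K (a K) t τ) (small K τ) (uA K) (uB K) (fun s => a K (lvl K s)))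
        (fun K t τ => histShell (νB K (a K) t τ) (small K τ) (uB K) (uA K) (fun s => a K (lvl K s)))
        fun K => (2 * ((N₁ + 1) * νbar * (M₁ / M₂ * (2 * (2 * νbar) / κmin)) * c₁ * ϑ⁻¹ ^ N₁)) * ϑ ^ K := by
  obtain ⟨a, hadm, hLA, hLB⟩ := levelLedgers_histories_of_marginalEnvelopes huA huB hsmall hθ hκ hρ hwin.count hwin.le_top hM₁ hM₂
    hdepA hdepB hΔ hcloseA hcloseB henvA henvB hmassA hmassB
  have hF : 0 ≤ 2 * νbar := by have := hwin.νbar_nonneg; positivity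
  have hD : ∀ j, M₁ / M₂ * (2 * νbar / ((1 - ρ j) * κ j)) ≤ M₁ / M₂ * (2 * (2 * νbar) / κmin) := fun j =>
    mul_le_mul_of_nonneg_left (levelConst_le hF (hρhalf j) hκmin (hκminle j)) (div_nonneg hM₁ hM₂.le)
  exact ⟨a, hadm, n21_knit_levels_geometric hLA hLB hwin hwin hD hD hϑ0 hϑ1 hrate hrate⟩

omit [∀ K a t τ, IsFiniteMeasure (νA K a t τ)] in
/-- **MODULE 20 IS THE SPECIAL CASE** `law ↦ law.map u_s`: Ω-valued older-causal envelopes give marginal ones with the same `hdep`, constants and masses.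
[folklore] -/
theorem marginal_binders_of_envelope {lawΩ : ∀ K : ℕ, (ℕ → ℝ) → σ → Measure (Ω K)} (hu : ∀ K s, Measurable (uA K s))
    (hdep : ∀ (K : ℕ) (s : σ) (a b : ℕ → ℝ), (∀ i, i < lvl K s → a i = b i) → lawΩ K a s = lawΩ K b s)
    (henv : ∀ (K : ℕ) (a : ℕ → ℝ), (∀ j, a j ∈ Icc ((1 - κ j) * θ j) (θ j)) → ∀ t, |t| ≤ l₀ → ∀ s ∈ C K,
      partialLaw (T K) (νA K a t) (small K) (uA K) (fun s => a (lvl K s)) s ≤ ENNReal.ofReal M₁ • lawΩ K a s) :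
    (∀ (K : ℕ) (s : σ) (a b : ℕ → ℝ), (∀ i, i < lvl K s → a i = b i) →
        (lawΩ K a s).map (uA K s) = (lawΩ K b s).map (uA K s)) ∧
      (∀ (K : ℕ) (a : ℕ → ℝ), (∀ j, a j ∈ Icc ((1 - κ j) * θ j) (θ j)) → ∀ t, |t| ≤ l₀ → ∀ s ∈ C K,
        (partialLaw (T K) (νA K a t) (small K) (uA K) (fun s => a (lvl K s)) s).map (uA K s) ≤
          ENNReal.ofReal M₁ • (lawΩ K a s).map (uA K s)) ∧
      (∀ K a s, (lawΩ K a s).map (uA K s) univ = lawΩ K a s univ) :=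
  ⟨fun K s a b hab => by rw [hdep K s a b hab],
    fun K a ha t ht s hs => marginalEnvelope_of_envelope (hu K s) (henv K a ha t ht s hs),
    fun K a s => map_univ_eq (hu K s)⟩

/-! ## §AM THE v9.0 JUNCTION: absorbing closeness (20k ∕ 20l) + older-causal MARGINAL envelopes — the shape that survives ℝ given decoupling -/

/-- **N21's ROAD I AT ABSORBING TERM LAWS WITH CAUSAL MARGINAL ENVELOPES.**  Closeness exactly as in 20l's `shellWeightBound_histories_of_absorbing`
(`hdetX` N16-det at the NOMINAL `θ` on `nbhd`, `hgeom : nbhd ⊆ smAll`, `habsX` absorption on `smAll` at the selected `a` — 20l's `hsub : small ⊆ smAll` was only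
used for its resummation step and is not needed here); the
(M1)-currency NOT the a-free resummation `hsumX` (strained by ℝ) but per window slot an OLDER-CAUSAL finite law on `ℝ` enveloping the family's
`u_s`-marginal over the `s`-small terms (`henvX`, loss `M₁`) with comparable mass (`hmassX`, loss `M₂`).  [folklore] -/
theorem shellWeightBound_histories_of_absorbing_marginal {N₁ : ℕ} {κmin c₁ ϑ : ℝ}
    (huA : ∀ K s, Measurable (uA K s)) (huB : ∀ K s, Measurable (uB K s))
    (hsmall : ∀ K, ∀ τ ∈ T K, small K τ ⊆ C K)
    (hθ : ∀ j, 0 < θ j) (hκ : ∀ j, 0 < κ j ∧ κ j ≤ 1) (hρ : ∀ j, 0 ≤ ρ j ∧ ρ j < 1)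
    (hwin : LiveWindow C lvl N₁ νbar) (hM₁ : 0 ≤ M₁) (hM₂ : 0 < M₂)
    (hdepA : ∀ (K : ℕ) (s : σ) (a b : ℕ → ℝ), (∀ i, i < lvl K s → a i = b i) → lawA K a s = lawA K b s)
    (hdepB : ∀ (K : ℕ) (s : σ) (a b : ℕ → ℝ), (∀ i, i < lvl K s → a i = b i) → lawB K a s = lawB K b s)
    (hΔ : ∀ j, Δ j ≤ ρ j * ((1 - κ j) * θ j))
    (hgeom : ∀ K, ∀ τ ∈ T K, ∀ s ∈ small K τ, nbhd K τ s ⊆ smAll K τ)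
    (hdetA : ∀ K, ∀ τ ∈ T K, ∀ s ∈ small K τ, ∀ ω, (∀ c ∈ nbhd K τ s, uA K c ω < θ (lvl K c)) → |uA K s ω - uB K s ω| ≤ Δ (lvl K s))
    (hdetB : ∀ K, ∀ τ ∈ T K, ∀ s ∈ small K τ, ∀ ω, (∀ c ∈ nbhd K τ s, uB K c ω < θ (lvl K c)) → |uB K s ω - uA K s ω| ≤ Δ (lvl K s))
    (habsA : ∀ (K : ℕ) (a : ℕ → ℝ), (∀ j, a j ∈ Icc ((1 - κ j) * θ j) (θ j)) → ∀ t, |t| ≤ l₀ → ∀ τ ∈ T K,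
      Absorbing (νA K a t τ) (smAll K τ) (uA K) (fun c => a (lvl K c)))
    (habsB : ∀ (K : ℕ) (a : ℕ → ℝ), (∀ j, a j ∈ Icc ((1 - κ j) * θ j) (θ j)) → ∀ t, |t| ≤ l₀ → ∀ τ ∈ T K,
      Absorbing (νB K a t τ) (smAll K τ) (uB K) (fun c => a (lvl K c)))
    (henvA : ∀ (K : ℕ) (a : ℕ → ℝ), (∀ j, a j ∈ Icc ((1 - κ j) * θ j) (θ j)) → ∀ t, |t| ≤ l₀ → ∀ s ∈ C K,
      (partialLaw (T K) (νA K a t) (small K) (uA K) (fun s => a (lvl K s)) s).map (uA K s) ≤ ENNReal.ofReal M₁ • lawA K a s)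
    (henvB : ∀ (K : ℕ) (a : ℕ → ℝ), (∀ j, a j ∈ Icc ((1 - κ j) * θ j) (θ j)) → ∀ t, |t| ≤ l₀ → ∀ s ∈ C K,
      (partialLaw (T K) (νB K a t) (small K) (uB K) (fun s => a (lvl K s)) s).map (uB K s) ≤ ENNReal.ofReal M₁ • lawB K a s)
    (hmassA : ∀ (K : ℕ) (a : ℕ → ℝ), (∀ j, a j ∈ Icc ((1 - κ j) * θ j) (θ j)) → ∀ t, |t| ≤ l₀ → ∀ s ∈ C K,
      M₂ * (lawA K a s univ).toReal ≤ ∑ τ ∈ T K, histWeight (νA K a t τ) (small K τ) (uA K) (fun s => a (lvl K s)))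
    (hmassB : ∀ (K : ℕ) (a : ℕ → ℝ), (∀ j, a j ∈ Icc ((1 - κ j) * θ j) (θ j)) → ∀ t, |t| ≤ l₀ → ∀ s ∈ C K,
      M₂ * (lawB K a s univ).toReal ≤ ∑ τ ∈ T K, histWeight (νB K a t τ) (small K τ) (uB K) (fun s => a (lvl K s)))
    (hκmin : 0 < κmin) (hκminle : ∀ j, κmin ≤ κ j) (hρhalf : ∀ j, ρ j ≤ 1 / 2)
    (hϑ0 : 0 < ϑ) (hϑ1 : ϑ < 1) (hrate : ∀ j, ρ j ≤ c₁ * ϑ ^ j) :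
    ∃ a : ℕ → ℕ → ℝ, (∀ K j, a K j ∈ Icc ((1 - κ j) * θ j) (θ j)) ∧
      ShellWeightBound l₀ T (fun K t τ => histWeight (νA K (a K) t τ) (small K τ) (uA K) (fun s => a K (lvl K s)))
        (fun K t τ => histWeight (νB K (a K) t τ) (small K τ) (uB K) (fun s => a K (lvl K s)))
        (fun K t τ => histShell (νA K (a K) t τ) (small K τ) (uA K) (uB K) (fun s => a K (lvl K s)))
        (fun K t τ => histShell (νB K (a K) t τ) (small K τ) (uB K) (uA K) (fun s => a K (lvl K s)))
        fun K => (2 * ((N₁ + 1) * νbar * (M₁ / M₂ * (2 * (2 * νbar) / κmin)) * c₁ * ϑ⁻¹ ^ N₁)) * ϑ ^ K :=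
  shellWeightBound_histories_of_marginalEnvelopes huA huB hsmall hθ hκ hρ hwin hM₁ hM₂ hdepA hdepB hΔ
    (fun K a ha t ht τ hτ => ae_close_of_absorbing (νA K a t τ) (nbhd K τ) (θ := fun c => θ (lvl K c)) (a := fun c => a (lvl K c))
      (Δ := fun s => Δ (lvl K s)) (hdetA K τ hτ) (hgeom K τ hτ) (fun c _ => (ha (lvl K c)).2) (habsA K a ha t ht τ hτ))
    (fun K a ha t ht τ hτ => ae_close_of_absorbing (νB K a t τ) (nbhd K τ) (θ := fun c => θ (lvl K c)) (a := fun c => a (lvl K c))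
      (Δ := fun s => Δ (lvl K s)) (hdetB K τ hτ) (hgeom K τ hτ) (fun c _ => (ha (lvl K c)).2) (habsB K a ha t ht τ hτ))
    henvA henvB hmassA hmassB hκmin hκminle hρhalf hϑ0 hϑ1 hrate

end TwoRuns

end Summit.QuantumFields.YangMills.Theorems.N21HistoriesMarginalEnvelopes
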